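import Literature.MathematicalPhysics.QuantumFieldTheory.Balaban1983to89.T4OutputRate
import Literature.MathematicalPhysics.QuantumFieldTheory.Balaban1983to89.B13Lemma3Torus

/-!
# Spine/NE5/TwoRunTorusNE5 — the torus-model two-run rate IS an instance of the typed estimate `T4OutputRate.NE5`,
# BY NAME (cell `pub-balaban-gaps`, seat `ne5` gen 7)

WHY.  `Spine/NE5/TwoRunTorusRate.norm_E_sub_le_torus` concludes, on the two-scale torus model at ONE paired scale,
`‖E^B(X)(φ) − E^A(X)(φ)‖ ≤ 2·(A e^{−κ′d_{k+1}(X)})∕ρ` on the space `sp2 X` (A = A₂C₃ε₁, κ′ = (1−10δ)½Lκ, ρ the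
radius of the holomorphic term pencil).  Row NE5's TYPED statement is `T4OutputRate.NE5 EA EB W κ θ C₅` over abstract
`Carriers` (domains with a creation scale and a tree length, two background types, a transport).  This file types the
junction: a FAMILY of torus models indexed by the creation scale `j` (torus `N j` cubes per direction, configuration
type `(W j).Φ`, spaces `(W j).sp2`), read as ONE `Carriers` (`torusCarriers`: domains `Σ j, 𝐃_{k+1}` of the `j`-th
torus, scale = `j`, `d` = the torus tree length, backgrounds = a configuration at every scale, transport = identity —
run A's dependence on the block-averaged background is inside its functional, as in the model), the two runs'
complex `E`-families read as REAL functionals (`reFunctional`: real part on the space, `0` off it — NE5's `E^{(j)}(X; U)`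
are real on real fields, [I] (0.24) p. 257), and the theorem `ne5_of_torus_rates`: IF at every scale `j` the E-layer
two-run rate holds with pencil radius `ρ_j = s ∕ θ^j` (margin `s` over the geometric two-run rate `θ^j` of rows
NE2∕NE3 — the radius at which `TwoRunPencilWalks.jointWalkExpansion_pencil_reach` keeps the walk package j-independent),
THEN `T4OutputRate.NE5 (reFunctional EA) (reFunctional EB) W κ′ θ (2A∕s)` — NE5 BY NAME, for every coupling window `W`;
`ne5_of_torus_rates_all_scales`: the honest all-scales form — the pencil rate is needed only where `θ^j < s` (rate below
the margin, `ρ_j > 1`); at the early scales the ONE-run (2.41) envelopes of the two runs give the same constant (census D1).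
So the output of the torus chain (2.26)-along-the-pencil ⇒ … ⇒ `norm_E_sub_le_torus` has EXACTLY the type the spine
consumes (`T4CauchySum.InjectedRate` via `Spine/NE5/LeafIndex`, `TowerFromPairs`), with `C₅ = 2A₂C₃ε₁∕s`.

HONEST FRAMING.  Bookkeeping (one `Carriers` instance, one read-out, one inequality chain); the family of torus models,
its `E`-families and the per-scale rates are HYPOTHESES; nothing of Bałaban's is constructed or asserted; NE5 on
Bałaban's carriers of record (`B13Carriers.TwoRuns`) is NOT proved — leaves 0∕12; (D4) 0∕1; spine 0∕9.  Rung (B)+1 on a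
FIXED finite T⁴ — NOT continuum, NOT infinite volume, NOT mass gap, NOT Clay.  HONEST DEPENDENCY: continuum YM on T⁴ ⇐
BetaPertH ∧ nine spine estimates; BetaPertH ⇐ (D1) ∧ (D4) ∧ CAP+tail.  0 sorry.

Sources: [I] = T. Bałaban, CMP **109** (1987) [Balaban1987RG1] (0.24)–(0.25) p. 257, (1.18) p. 263; [II] = CMP **116**
(1988) [Balaban1988RG2Cluster] (2.41) p. 21; C. King, CMP **102** (1986) [King1986] Thm 3.4 p. 656.  Nothing here is a
claim about the Yang–Mills mass gap.
-/

noncomputable section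

namespace Summit.QuantumFields.BalabanUV.T4Continuum.Spine.NE5.TwoRunTorusNE5

open Metric Set
open Literature.MathematicalPhysics.QuantumFieldTheory.Balaban1983to89
open Literature.MathematicalPhysics.QuantumFieldTheory.Balaban1983to89.T4OutputRate (Carriers Functional NE5)
open Literature.MathematicalPhysics.QuantumFieldTheory.Balaban1983to89.TreeLengthTorus (TPt TDom tsys)
open Literature.MathematicalPhysics.QuantumFieldTheory.Balaban1983to89.B13Lemma3Torus (TwoTorusStep)

variable {L : ℕ} [NeZero L]

/-- **The carriers of a family of torus models indexed by the creation scale.**  Domains: `Σ j, 𝐃_{k+1}` of the `j`-th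
torus (`N j` cubes per direction); `scale ⟨j, X⟩ = j`; `d ⟨j, X⟩` = the torus tree length of `X`; both background types
= a configuration of every scale's model, `Π j, (W j).Φ` (the scale-`j` functional reads component `j`); gauge `0`;
transport = identity (in the model run A's dependence on the block-averaged run-B background is inside `E^A`).
[cite: Balaban1987RG1, (0.24) p.257, (1.18) p.263] -/
def torusCarriers (N : ℕ → ℕ) [∀ j, NeZero (N j)] (W : (j : ℕ) → TwoTorusStep 4 L (N j)) : Carriers where
  Dom := Σ j : ℕ, TDom 4 (N j)
  scale := fun X => X.1
  d := fun X => (tsys 4 (N X.1)).dj X.2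
  d_nonneg := fun X => (tsys 4 (N X.1)).dj_nonneg X.2
  BgA := (j : ℕ) → (W j).Φ
  BgB := (j : ℕ) → (W j).Φ
  gauge := fun _ _ => 0
  gauge_nonneg := fun _ _ => le_rfl
  transport := id

open Classical in
/-- **A complex `E`-family of the torus models read as a REAL functional on the carriers**: at the domain `⟨j, X⟩` and
the background `U`, the real part of `E j X (U j)` if `U j` lies in the space `(W j).sp2 X` of p. 15, and `0` otherwise
(print's `E^{(j)}(X; U)` are real on real fields and analytic on the complex space; the coupling argument is not read by
the model). [cite: Balaban1987RG1, (0.24) p.257] -/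
def reFunctional (N : ℕ → ℕ) [∀ j, NeZero (N j)] (W : (j : ℕ) → TwoTorusStep 4 L (N j))
    (E : (j : ℕ) → TDom 4 (N j) → (W j).Φ → ℂ) :
    Functional (torusCarriers N W) (torusCarriers N W).BgB :=
  fun _ U X => if U X.1 ∈ (W X.1).sp2 X.2 then (E X.1 X.2 (U X.1)).re else 0

open Classical in
/-- **NE5 BY NAME FROM THE PER-SCALE TORUS RATES.**  If at every creation scale `j` the two runs' `E`-families of the
`j`-th torus model differ on the space by at most `2·(A e^{−κ′ d(X)}) ∕ (s ∕ θ^j)` — the conclusion of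
`TwoRunTorusRate.norm_E_sub_le_torus` with pencil radius `ρ_j = s∕θ^j` (`A = A₂C₃ε₁`, `κ′ = (1−10δ)½Lκ`; `0 < θ`,
`0 < s`, `0 ≤ A`) — then the typed spine estimate holds for the real read-outs on the torus carriers, for every
coupling window `W′`: `T4OutputRate.NE5 (reFunctional EA) (reFunctional EB) W′ κ′ θ (2A∕s)`.
[cite: Balaban1987RG1, (1.18) p.263; King1986, Thm 3.4 (3.9) p.656] -/
theorem ne5_of_torus_rates (N : ℕ → ℕ) [∀ j, NeZero (N j)] (W : (j : ℕ) → TwoTorusStep 4 L (N j))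
    (EA EB : (j : ℕ) → TDom 4 (N j) → (W j).Φ → ℂ) {A κ' θ s : ℝ} (hA : 0 ≤ A) (hθ : 0 < θ) (hs : 0 < s)
    (hE : ∀ (j : ℕ) (X : TDom 4 (N j)) (φ : (W j).Φ), φ ∈ (W j).sp2 X →
      ‖EB j X φ - EA j X φ‖ ≤ 2 * (A * Real.exp (-(κ' * (tsys 4 (N j)).dj X))) / (s / θ ^ j))
    (W' : Set (ℕ → ℝ)) :
    NE5 (C := torusCarriers N W) (reFunctional N W EA) (reFunctional N W EB) W' κ' θ (2 * A / s) := by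
  intro g _ U X
  obtain ⟨j, X⟩ := X
  show |reFunctional N W EA g (id U) ⟨j, X⟩ - reFunctional N W EB g U ⟨j, X⟩| ≤
    2 * A / s * θ ^ j * Real.exp (-(κ' * (tsys 4 (N j)).dj X))
  by_cases hφ : U j ∈ (W j).sp2 X
  · simp only [reFunctional, id, hφ, if_true]
    have h := hE j X (U j) hφ
    have hθj : 0 < θ ^ j := pow_pos hθ j
    calc |(EA j X (U j)).re - (EB j X (U j)).re| = |(EA j X (U j) - EB j X (U j)).re| := by
          rw [Complex.sub_re]
      _ ≤ ‖EA j X (U j) - EB j X (U j)‖ := Complex.abs_re_le_norm _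
      _ = ‖EB j X (U j) - EA j X (U j)‖ := norm_sub_rev _ _
      _ ≤ 2 * (A * Real.exp (-(κ' * (tsys 4 (N j)).dj X))) / (s / θ ^ j) := h
      _ = 2 * A / s * θ ^ j * Real.exp (-(κ' * (tsys 4 (N j)).dj X)) := by
          field_simp
  · simp only [reFunctional, id, hφ, if_false, sub_zero, abs_zero]
    positivity

/-- **The early scales need no pencil** (census D1 of `ne/NE5.md`: at scales where the two-run rate `θ^j` has not yet
dropped below the margin `s`, NE5's inequality follows from the ONE-run bounds): if `s ≤ θ^j` then
`‖E^B − E^A‖ ≤ ‖E^B‖ + ‖E^A‖ ≤ 2M ≤ (2M∕s)·θ^j`. [folklore] -/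
theorem norm_sub_le_of_one_run {EA EB : ℂ} {Mb s θj : ℝ} (hs : 0 < s) (hsθ : s ≤ θj)
    (hA : ‖EA‖ ≤ Mb) (hB : ‖EB‖ ≤ Mb) : ‖EB - EA‖ ≤ 2 * Mb / s * θj := by
  have hM : 0 ≤ Mb := (norm_nonneg _).trans hA
  calc ‖EB - EA‖ ≤ ‖EB‖ + ‖EA‖ := norm_sub_le _ _
    _ ≤ 2 * Mb := by linarith
    _ = 2 * Mb / s * s := by field_simp
    _ ≤ 2 * Mb / s * θj := by gcongr

open Classical in
/-- **NE5 BY NAME FROM THE PER-SCALE TORUS DATA, ALL SCALES** (the honest form: pencil where the rate has dropped below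
the margin, one-run bounds before).  At every creation scale `j`: the two runs' `E`-families obey the ONE-run (2.41)
envelope `‖E(X)‖ ≤ A e^{−κ′d(X)}` on the space (each run's own `B13.Bound241`), and WHENEVER `θ^j < s` the two-run rate
with pencil radius `ρ_j = s∕θ^j > 1` (the conclusion of `TwoRunTorusRate.norm_E_sub_le_torus`).  Then
`T4OutputRate.NE5 (reFunctional EA) (reFunctional EB) W′ κ′ θ (2A∕s)` for every coupling window — with NO restriction
on the scale: for `s ≤ θ^j` the one-run bounds give the same constant (`norm_sub_le_of_one_run`).
[cite: Balaban1987RG1, (1.18) p.263; King1986, Thm 3.4 (3.9) p.656] -/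
theorem ne5_of_torus_rates_all_scales (N : ℕ → ℕ) [∀ j, NeZero (N j)] (W : (j : ℕ) → TwoTorusStep 4 L (N j))
    (EA EB : (j : ℕ) → TDom 4 (N j) → (W j).Φ → ℂ) {A κ' θ s : ℝ} (hA : 0 ≤ A) (hθ : 0 < θ) (hs : 0 < s)
    (hA1 : ∀ (j : ℕ) (X : TDom 4 (N j)) (φ : (W j).Φ), φ ∈ (W j).sp2 X →
      ‖EA j X φ‖ ≤ A * Real.exp (-(κ' * (tsys 4 (N j)).dj X)))
    (hB1 : ∀ (j : ℕ) (X : TDom 4 (N j)) (φ : (W j).Φ), φ ∈ (W j).sp2 X →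
      ‖EB j X φ‖ ≤ A * Real.exp (-(κ' * (tsys 4 (N j)).dj X)))
    (hE : ∀ (j : ℕ), θ ^ j < s → ∀ (X : TDom 4 (N j)) (φ : (W j).Φ), φ ∈ (W j).sp2 X →
      ‖EB j X φ - EA j X φ‖ ≤ 2 * (A * Real.exp (-(κ' * (tsys 4 (N j)).dj X))) / (s / θ ^ j))
    (W' : Set (ℕ → ℝ)) :
    NE5 (C := torusCarriers N W) (reFunctional N W EA) (reFunctional N W EB) W' κ' θ (2 * A / s) := by
  refine ne5_of_torus_rates N W EA EB hA hθ hs (fun j X φ hφ => ?_) W'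
  by_cases hj : θ ^ j < s
  · exact hE j hj X φ hφ
  · have h := norm_sub_le_of_one_run hs (not_lt.1 hj) (hA1 j X φ hφ) (hB1 j X φ hφ)
    have hθj : 0 < θ ^ j := pow_pos hθ j
    calc ‖EB j X φ - EA j X φ‖ ≤ 2 * (A * Real.exp (-(κ' * (tsys 4 (N j)).dj X))) / s * θ ^ j := h
      _ = 2 * (A * Real.exp (-(κ' * (tsys 4 (N j)).dj X))) / (s / θ ^ j) := by field_simp

/-- **The constant of the junction**: with `A = A₂C₃ε₁` the NE5 constant is `C₅ = 2A₂C₃ε₁∕s` and the NE5 rate is the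
two-run rate `θ` of rows NE2∕NE3 — recorded as an identity for the census (`ne/NE5.md` §7). [folklore] -/
theorem ne5_constant (A₂ C3 ε₁ s : ℝ) : 2 * (A₂ * C3 * ε₁) / s = 2 * A₂ * C3 * ε₁ / s := by ring

end Summit.QuantumFields.BalabanUV.T4Continuum.Spine.NE5.TwoRunTorusNE5

end
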